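/-
COR-CM (cell pub-hodgecm2, stage 2 of the Hodge ladder) — count-neutral census DICTIONARY supplement «reading-stable types are
induced from fixed fields» (seat prover-pub-hodgecm2-b09-g22-0, binder prover b09, gen 22; own lane DEG12-MARKMAN-FRAME,
HOME/INBOX.md l.5648, complement BY NAME to seat b23's DEG12-MARKMAN-TRANSPORT l.5632).  Theorems only: field theory of a
Galois number field `K` read through an automorphism dictionary `ε : Aut(K) ≃ Fin n` against a census table `Γ`
(`Census/FaceSquaresModel.lean`, seat b30, BY NAME).  No definition, no named fact, nothing asserted; `Interfaces.lean` (C1),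
every E term, `B01/*`, `Transposition/*`, `HComp/*` untouched.  HONEST FRAMING (COORDINATOR RULING — HODGE FRAMING CORRECTION,
2026-08-21T11:55:35Z): `HC_CM` is NOT proved, here or anywhere in the tree; nothing below mentions a period or a Hodge class.
T5: n/a-class (no Prop-valued hypothesis binder beyond data descriptions; Mathlib Galois theory only).
-/
import Summits.HodgeConjecture.CorCM.FaceCensusGroupDictionary
import Literature.NumberTheory.ComplexMultiplication.CMTypeInducedFromPrimitive
import HarnessLib

/-!
# Census dictionary: a CM type whose code is right-stable under a subgroup is induced from the fixed field

The finite census model of seat b30 (`Census/FaceSquaresModel.lean`) reads a CM type `Θ` of a Galois CM field `K` at a base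
embedding `σ₀` as the bitmask `T` of the automorphisms `g` with `σ₀ ∘ g ∈ Θ` (through a bijection `ε : Aut(K) ≃ Fin n` that is
multiplicative for the Cayley table `Γ`); its LABELS paragraph records the folklore dictionary «the right stabiliser `H = Stab(T)`
cuts out the subfield `K^H` and `A_T ∼ B^{|H|}` with `B = A_{(K^H, T/H)}`».  This file proves the field-theoretic half of that
dictionary in the tree's vocabulary (Mathlib `IntermediateField.fixedField`, the tree's `inducedCMType`, Streng Def. I.3.2), so that
a census seat holding only `(σ₀, ε)` and type READINGS can hand induced types to the tree theorems that consume them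
(Shimura's type inflation `Shimura1998_Thm3_isogenousPower`, seat b07's `InducedCurveThreefold.*`):

* §1 (pure field theory, any subgroup `H ≤ Aut(K)`): `comp_algebraMap_fixedField_eq_iff` — `σ₀∘g` and `σ₀∘g'` agree on `K^H`
  iff `g⁻¹ g' ∈ H` (Artin, `IntermediateField.fixingSubgroup_fixedField`); **`exists_inducedCMType_of_comp_stable`** — a CM type
  stable under precomposition with `H` is `Φ^K` for a CM type `Φ` of `K^H` (the general form of seat b30's
  `CyclicSextic.exists_inducedCMType_of_sq_stable`); `finrank_fixedField_mul_card` (`[K^H:ℚ]·|H| = [K:ℚ]`).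
* §2 (through the dictionary `(Γ, ε)`): `autEnum_one`, `exists_subgroup_of_mask` (a mask containing `Γ.one` and closed under
  `Γ.mul` is the code set of a subgroup), `card_subgroup_of_mask`, **`exists_inducedCMType_of_reads`** (a type reading as `T`
  with `T·j = T` for the codes `j` of `H` is induced from `K^H`), `comp_algebraMap_mem_iff_of_inducedCMType_eq` (the induced type
  read on `K^H`), **`exists_comp_ne_of_codes`** — Milne's «not induced from the smaller field `K^{H'}`» for `Φ` on `K^H`, `H ≤ H'`,
  from two codes of `T` in different right `H'`-cosets (the hypothesis shape `hprim` of seat b07's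
  `InducedCurveThreefold.hodgeConjectureFor_cmProdAV_inducedCMType_pair_of_markman`), `exists_cmType_reads` (every CM-type code IS
  read by a CM type of `K`: non-vacuity) and `reads_galT_of_reads_aut` (automorphism readings ⟹ `GalT` readings, the transport's
  currency).

Every hypothesis on codes is a closed `Bool`/`Fin n` statement a per-type file discharges by `decide`.  USE: the degree-12
Markman families (`CorCM/DuodecicMarkmanFamilies.lean`, filed separately).  `HC_CM` is NOT proved.

References: [cite: Shimura1998, §8.1–§8.2 (types induced from a subfield; Prop. 26)]; [cite: Streng2010, Ch. I Def. 3.2,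
Lemma 3.5]; [cite: MilneCM2006, Ch. I §1 p. 11]; Mathlib `IntermediateField.fixedField`, `finrank_fixedField_eq_card`,
`fixingSubgroup_fixedField`.
-/

noncomputable section

open NumberField NumberField.ComplexEmbedding

namespace Summit.HodgeConjecture.CorCM.FaceCensus

open Literature.AlgebraicGeometry.Motives (CMType)
open Literature.NumberTheory.ComplexMultiplication (inducedCMType mem_inducedCMType_iff conjugate_comp_ringHom)
open Summit.HodgeConjecture.CorCM.Census.FaceSquaresModel

/-! ## §1 Field theory: restriction to a fixed field, induced types, degree -/

section FieldTheory

variable {K : Type} [Field K] [NumberField K]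

/-- **`σ₀ ∘ g` and `σ₀ ∘ g'` agree on the fixed field `K^H` iff `g⁻¹ g' ∈ H`** (Artin: `Aut(K/K^H) = H`, Mathlib
`IntermediateField.fixingSubgroup_fixedField`). [cite: Shimura1998, §8.1] -/
theorem comp_algebraMap_fixedField_eq_iff (σ₀ : K →+* ℂ) (H : Subgroup (K ≃ₐ[ℚ] K)) (g g' : K ≃ₐ[ℚ] K) :
    (σ₀.comp (g : K →+* K)).comp (algebraMap (IntermediateField.fixedField H) K) =
        (σ₀.comp (g' : K →+* K)).comp (algebraMap (IntermediateField.fixedField H) K) ↔ g⁻¹ * g' ∈ H := by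
  have key : (σ₀.comp (g : K →+* K)).comp (algebraMap (IntermediateField.fixedField H) K) =
      (σ₀.comp (g' : K →+* K)).comp (algebraMap (IntermediateField.fixedField H) K) ↔
      ∀ x ∈ IntermediateField.fixedField H, (g⁻¹ * g') x = x := by
    constructor
    · intro h x hx
      have hx' := RingHom.congr_fun h ⟨x, hx⟩
      simp only [RingHom.coe_comp, RingHom.coe_coe, Function.comp_apply, IntermediateField.algebraMap_apply] at hx'
      have h1 : g x = g' x := σ₀.injective hx'
      rw [AlgEquiv.mul_apply, ← h1]
      exact g.symm_apply_apply x
    · intro h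
      refine RingHom.ext fun x => ?_
      simp only [RingHom.coe_comp, RingHom.coe_coe, Function.comp_apply, IntermediateField.algebraMap_apply]
      have hx := h x.1 x.2
      rw [AlgEquiv.mul_apply] at hx
      have hx' : g (g⁻¹ (g' (x : K))) = g x := by rw [hx]
      rw [show g (g⁻¹ (g' (x : K))) = g' x from g.apply_symm_apply _] at hx'
      rw [hx']
  rw [key, ← IntermediateField.mem_fixingSubgroup_iff, IntermediateField.fixingSubgroup_fixedField]

/-- The elements of `H` fix `K^H` pointwise, so `σ₀ ∘ g ∘ h` and `σ₀ ∘ g` agree on `K^H` for `h ∈ H`. [folklore] -/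
theorem comp_comp_algebraMap_fixedField_of_mem (φ : K →+* ℂ) (H : Subgroup (K ≃ₐ[ℚ] K)) {h : K ≃ₐ[ℚ] K} (hh : h ∈ H) :
    (φ.comp (h : K →+* K)).comp (algebraMap (IntermediateField.fixedField H) K) =
      φ.comp (algebraMap (IntermediateField.fixedField H) K) := by
  refine RingHom.ext fun x => ?_
  simp only [RingHom.coe_comp, RingHom.coe_coe, Function.comp_apply, IntermediateField.algebraMap_apply]
  exact congrArg φ ((IntermediateField.mem_fixedField_iff H x.1).mp x.2 h hh)

variable [IsGalois ℚ K]

/-- **Fibres of restriction to `K^H` are `H`-orbits**: two complex embeddings of `K` with the same restriction to `K^H` differ by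
precomposition with an element of `H` (`K/ℚ` Galois: every embedding is `σ₀ ∘ g`, tree `exists_aut_eq`; then
`comp_algebraMap_fixedField_eq_iff`). [cite: Shimura1998, §8.1] -/
theorem exists_mem_comp_eq_of_comp_algebraMap_eq (H : Subgroup (K ≃ₐ[ℚ] K)) (φ ψ : K →+* ℂ)
    (h : φ.comp (algebraMap (IntermediateField.fixedField H) K) = ψ.comp (algebraMap (IntermediateField.fixedField H) K)) :
    ∃ u ∈ H, ψ = φ.comp (u : K →+* K) := by
  obtain ⟨g', rfl⟩ := exists_aut_eq φ ψ
  refine ⟨g', ?_, rfl⟩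
  have h1 := (comp_algebraMap_fixedField_eq_iff φ H 1 g').mp (by rwa [comp_coe_one])
  rwa [inv_one, one_mul] at h1

/-- **A CM type stable under precomposition with `H` is induced from the fixed field `K^H`** (Streng Def. I.3.2,
`inducedCMType`): `Θ = Φ^K` with `Φ = {φ|_{K^H} : φ ∈ Θ}` — the general form of seat b30's
`CyclicSextic.exists_inducedCMType_of_sq_stable` (there `H = ⟨σ²⟩`). [cite: Shimura1998, §8.2 (types induced from a subfield)]
[cite: Streng2010, Ch. I Def. 3.2] -/
theorem exists_inducedCMType_of_comp_stable (H : Subgroup (K ≃ₐ[ℚ] K)) (Θ : CMType K)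
    (hst : ∀ u ∈ H, ∀ φ : K →+* ℂ, φ.comp (u : K →+* K) ∈ Θ.1 ↔ φ ∈ Θ.1) :
    ∃ Φ : CMType (IntermediateField.fixedField H),
      inducedCMType (algebraMap (IntermediateField.fixedField H) K) Φ = Θ := by
  set k := IntermediateField.fixedField H with hk
  -- embeddings with the same restriction lie in `Θ` together
  have hfib : ∀ φ ψ : K →+* ℂ, φ.comp (algebraMap k K) = ψ.comp (algebraMap k K) → (φ ∈ Θ.1 ↔ ψ ∈ Θ.1) := by
    intro φ ψ h
    obtain ⟨u, hu, rfl⟩ := exists_mem_comp_eq_of_comp_algebraMap_eq H φ ψ h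
    exact (hst u hu φ).symm
  let S₀ : Set (k →+* ℂ) := {τ | ∃ φ : K →+* ℂ, φ ∈ Θ.1 ∧ φ.comp (algebraMap k K) = τ}
  have hS₀ : ∀ τ : k →+* ℂ, τ ∈ S₀ ↔ conjugate τ ∉ S₀ := by
    intro τ
    constructor
    · rintro ⟨φ, hφ, rfl⟩ ⟨ψ, hψ, hψτ⟩
      rw [conjugate_comp_ringHom] at hψτ
      have hc : conjugate φ ∈ Θ.1 := (hfib (conjugate φ) ψ hψτ.symm).mpr hψ
      exact ((Θ.2 φ).mp hφ) hc
    · intro hτ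
      have hlift : (ComplexEmbedding.lift K τ).comp (algebraMap k K) = τ := ComplexEmbedding.lift_comp_algebraMap K τ
      by_cases hφ : ComplexEmbedding.lift K τ ∈ Θ.1
      · exact ⟨_, hφ, hlift⟩
      · exfalso
        apply hτ
        refine ⟨conjugate (ComplexEmbedding.lift K τ),
          (Literature.NumberTheory.ComplexMultiplication.CMTypeOps.conjugate_mem_iff_notMem Θ _).mpr hφ, ?_⟩
        rw [← conjugate_comp_ringHom, hlift]
  refine ⟨⟨S₀, hS₀⟩, Subtype.ext (Set.ext fun φ => ?_)⟩
  change φ.comp (algebraMap k K) ∈ S₀ ↔ φ ∈ Θ.1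
  constructor
  · rintro ⟨ψ, hψ, h⟩
    exact (hfib ψ φ h).mp hψ
  · intro hφ
    exact ⟨φ, hφ, rfl⟩

omit [IsGalois ℚ K] in
/-- **Degree of the fixed field**: `[K^H:ℚ] · |H| = [K:ℚ]` (tower law with `[K:K^H] = |H|`, Mathlib
`IntermediateField.finrank_fixedField_eq_card`). [folklore] -/
theorem finrank_fixedField_mul_card (H : Subgroup (K ≃ₐ[ℚ] K)) :
    Module.finrank ℚ (IntermediateField.fixedField H) * Nat.card H = Module.finrank ℚ K := by
  rw [← IntermediateField.finrank_fixedField_eq_card, Module.finrank_mul_finrank]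

omit [IsGalois ℚ K] in
/-- Nested subgroups give nested fixed fields the other way round. [folklore] -/
theorem fixedField_le_of_le {H H' : Subgroup (K ≃ₐ[ℚ] K)} (h : H ≤ H') :
    IntermediateField.fixedField H' ≤ IntermediateField.fixedField H :=
  IntermediateField.fixedField_le h

end FieldTheory

/-! ## §2 Through the dictionary `(Γ, ε)`: subgroups and induced types from codes -/

section Codes

variable {n : ℕ} (Γ : CMGaloisType n) {K : Type} [Field K] [NumberField K] (ε : (K ≃ₐ[ℚ] K) ≃ Fin n)

/-- **The identity reads as `Γ.one`**, provided the table's `one` is idempotent (part of `isCMGaloisType`; each census file's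
`group_spec`): `ε 1` is the unique idempotent of the transported group law. [folklore] -/
theorem autEnum_one (hε : ∀ g h : K ≃ₐ[ℚ] K, ε (g * h) = Γ.mul (ε g) (ε h)) (h1 : Γ.mul Γ.one Γ.one = Γ.one) :
    ε 1 = Γ.one := by
  have h : ε.symm Γ.one * ε.symm Γ.one = ε.symm Γ.one := by
    apply ε.injective
    rw [hε, ε.apply_symm_apply, h1]
  rw [mul_eq_left] at h
  rw [← h, ε.apply_symm_apply]

/-- Powers stay inside a multiplicatively closed code mask. [folklore] -/
theorem mem_mask_pow (hε : ∀ g h : K ≃ₐ[ℚ] K, ε (g * h) = Γ.mul (ε g) (ε h)) {SH : ℕ}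
    (hcl : ∀ i j : Fin n, mem i SH = true → mem j SH = true → mem (Γ.mul i j) SH = true)
    {g : K ≃ₐ[ℚ] K} (hg : mem (ε g) SH = true) (k : ℕ) : mem (ε (g ^ (k + 1))) SH = true := by
  induction k with
  | zero => rwa [zero_add, pow_one]
  | succ k ih => rw [pow_succ, hε]; exact hcl _ _ ih hg

/-- **A code mask containing `Γ.one` and closed under `Γ.mul` is the code set of a subgroup of `Aut(K)`** (inverses come for free
in a finite group: `g⁻¹ = g^{ord g - 1}`). [folklore] -/
theorem exists_subgroup_of_mask (hε : ∀ g h : K ≃ₐ[ℚ] K, ε (g * h) = Γ.mul (ε g) (ε h)) (h1 : Γ.mul Γ.one Γ.one = Γ.one)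
    (SH : ℕ) (hone : mem Γ.one SH = true)
    (hcl : ∀ i j : Fin n, mem i SH = true → mem j SH = true → mem (Γ.mul i j) SH = true) :
    ∃ H : Subgroup (K ≃ₐ[ℚ] K), ∀ g : K ≃ₐ[ℚ] K, g ∈ H ↔ mem (ε g) SH = true := by
  refine ⟨{ carrier := {g | mem (ε g) SH = true}
            mul_mem' := fun {a b} ha hb => by
              simp only [Set.mem_setOf_eq] at ha hb ⊢
              rw [hε]; exact hcl _ _ ha hb
            one_mem' := by simp only [Set.mem_setOf_eq]; rw [autEnum_one Γ ε hε h1]; exact hone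
            inv_mem' := fun {g} hg => by
              simp only [Set.mem_setOf_eq] at hg ⊢
              have ho : 0 < orderOf g := orderOf_pos g
              have hinv : g⁻¹ = g ^ (orderOf g - 1) := by
                rw [eq_comm, ← mul_eq_one_iff_eq_inv, ← pow_succ, Nat.sub_add_cancel ho, pow_orderOf_eq_one]
              rw [hinv]
              rcases Nat.exists_eq_add_of_le ho with ⟨m, hm⟩
              rw [hm, Nat.add_sub_cancel_left]
              rcases m with _ | m
              · rw [pow_zero, autEnum_one Γ ε hε h1]; exact hone
              · exact mem_mask_pow Γ ε hε hcl hg m }, fun g => Iff.rfl⟩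

/-- **The order of the subgroup with code mask `SH`** is the number of indices in the mask. [folklore] -/
theorem card_subgroup_of_mask (H : Subgroup (K ≃ₐ[ℚ] K)) {SH : ℕ} (hH : ∀ g : K ≃ₐ[ℚ] K, g ∈ H ↔ mem (ε g) SH = true) :
    Nat.card H = (Finset.univ.filter fun i : Fin n => mem i SH = true).card := by
  classical
  have e : H ≃ {i : Fin n // mem i SH = true} :=
    { toFun := fun g => ⟨ε g.1, (hH g.1).mp g.2⟩
      invFun := fun i => ⟨ε.symm i.1, (hH _).mpr (by rw [ε.apply_symm_apply]; exact i.2)⟩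
      left_inv := fun g => Subtype.ext (by simp)
      right_inv := fun i => Subtype.ext (by simp) }
  rw [Nat.card_congr e, Nat.card_eq_fintype_card, Fintype.card_subtype]

/-- Membership of `ε⁻¹ j` in the subgroup with code mask `SH`. [folklore] -/
theorem symm_mem_of_mask (H : Subgroup (K ≃ₐ[ℚ] K)) {SH : ℕ} (hH : ∀ g : K ≃ₐ[ℚ] K, g ∈ H ↔ mem (ε g) SH = true)
    {j : Fin n} (hj : mem j SH = true) : ε.symm j ∈ H := by
  rw [hH, ε.apply_symm_apply]; exact hj

variable [IsGalois ℚ K]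

/-- **A CM type reading as a code right-stable under the codes of `H` is induced from `K^H`.**  `σ₀` a base embedding, `Θ` a CM
type with `σ₀ ∘ g ∈ Θ ↔ ε g ∈ T`, and `T·j = T` for every code `j` of `H` (`mem (Γ.mul i j) T ↔ mem i T`): then `Θ = Φ^K` for a CM
type `Φ` of `K^H`. [cite: Shimura1998, §8.2] [cite: Streng2010, Ch. I Def. 3.2] -/
theorem exists_inducedCMType_of_reads (hε : ∀ g h : K ≃ₐ[ℚ] K, ε (g * h) = Γ.mul (ε g) (ε h)) (σ₀ : K →+* ℂ)
    (H : Subgroup (K ≃ₐ[ℚ] K)) {SH : ℕ} (hH : ∀ g : K ≃ₐ[ℚ] K, g ∈ H ↔ mem (ε g) SH = true)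
    (Θ : CMType K) {T : ℕ} (hΘ : ∀ g : K ≃ₐ[ℚ] K, σ₀.comp (g : K →+* K) ∈ Θ.1 ↔ mem (ε g) T = true)
    (hstab : ∀ i j : Fin n, mem j SH = true → (mem (Γ.mul i j) T = true ↔ mem i T = true)) :
    ∃ Φ : CMType (IntermediateField.fixedField H),
      inducedCMType (algebraMap (IntermediateField.fixedField H) K) Φ = Θ := by
  refine exists_inducedCMType_of_comp_stable H Θ fun u hu φ => ?_
  obtain ⟨g, rfl⟩ := exists_aut_eq σ₀ φ
  rw [← comp_coe_mul, hΘ, hΘ, hε]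
  exact hstab _ _ ((hH u).mp hu)

omit [IsGalois ℚ K] in
/-- **The induced type read on the subfield**: if `Φ^K = Θ` then `(σ₀ ∘ g)|_{K^H} ∈ Φ ↔ σ₀ ∘ g ∈ Θ`. [folklore] -/
theorem comp_algebraMap_mem_iff_of_inducedCMType_eq (σ₀ : K →+* ℂ) (H : Subgroup (K ≃ₐ[ℚ] K))
    {Φ : CMType (IntermediateField.fixedField H)} {Θ : CMType K}
    (hΦ : inducedCMType (algebraMap (IntermediateField.fixedField H) K) Φ = Θ) (g : K ≃ₐ[ℚ] K) :
    (σ₀.comp (g : K →+* K)).comp (algebraMap (IntermediateField.fixedField H) K) ∈ Φ.1 ↔ σ₀.comp (g : K →+* K) ∈ Θ.1 := by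
  rw [← hΦ, mem_inducedCMType_iff]

omit [IsGalois ℚ K] in
/-- **Milne's non-inducedness in codes.**  `H ≤ H'` subgroups with code masks `SH`, `SH'`; `Φ` a CM type of `K^H` with `Φ^K`
reading as `T`; two codes `i₁, i₂ ∈ T` with `i₂ ∉ i₁·H'` (`Γ.mul i₁ j ≠ i₂` for all codes `j` of `H'`).  Then two members of `Φ`
restrict DIFFERENTLY to `K^{H'}` along any `i : K^{H'} → K^H` over `K` — `Φ` is not induced from `K^{H'}` along `i` (the hypothesis `hprim` of
seat b07's `InducedCurveThreefold.hodgeConjectureFor_cmProdAV_inducedCMType_pair_of_markman`).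
[cite: MilneCM2006, Ch. I §1 p. 11] [cite: Shimura1998, §8.2 Prop. 26] -/
theorem exists_comp_ne_of_codes (hε : ∀ g h : K ≃ₐ[ℚ] K, ε (g * h) = Γ.mul (ε g) (ε h)) (σ₀ : K →+* ℂ)
    {H H' : Subgroup (K ≃ₐ[ℚ] K)} {SH' : ℕ} (hH' : ∀ g : K ≃ₐ[ℚ] K, g ∈ H' ↔ mem (ε g) SH' = true)
    (i : IntermediateField.fixedField H' →+* IntermediateField.fixedField H)
    (hi : (algebraMap (IntermediateField.fixedField H) K).comp i = algebraMap (IntermediateField.fixedField H') K)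
    {Φ : CMType (IntermediateField.fixedField H)} {Θ : CMType K}
    (hΦ : inducedCMType (algebraMap (IntermediateField.fixedField H) K) Φ = Θ) {T : ℕ}
    (hΘ : ∀ g : K ≃ₐ[ℚ] K, σ₀.comp (g : K →+* K) ∈ Θ.1 ↔ mem (ε g) T = true)
    (i₁ i₂ : Fin n) (hi₁ : mem i₁ T = true) (hi₂ : mem i₂ T = true)
    (hsep : ∀ j : Fin n, mem j SH' = true → Γ.mul i₁ j ≠ i₂) :
    ∃ s ∈ Φ.1, ∃ s' ∈ Φ.1, s.comp i ≠ s'.comp i := by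
  refine ⟨(σ₀.comp ((ε.symm i₁ : K ≃ₐ[ℚ] K) : K →+* K)).comp (algebraMap (IntermediateField.fixedField H) K),
    (comp_algebraMap_mem_iff_of_inducedCMType_eq σ₀ H hΦ _).mpr ((hΘ _).mpr (by rw [ε.apply_symm_apply]; exact hi₁)),
    (σ₀.comp ((ε.symm i₂ : K ≃ₐ[ℚ] K) : K →+* K)).comp (algebraMap (IntermediateField.fixedField H) K),
    (comp_algebraMap_mem_iff_of_inducedCMType_eq σ₀ H hΦ _).mpr ((hΘ _).mpr (by rw [ε.apply_symm_apply]; exact hi₂)), ?_⟩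
  intro h
  -- the two composites are the restrictions to `K^{H'}`
  have h' : (σ₀.comp ((ε.symm i₁ : K ≃ₐ[ℚ] K) : K →+* K)).comp (algebraMap (IntermediateField.fixedField H') K) =
      (σ₀.comp ((ε.symm i₂ : K ≃ₐ[ℚ] K) : K →+* K)).comp (algebraMap (IntermediateField.fixedField H') K) := by
    rw [← hi, ← RingHom.comp_assoc, ← RingHom.comp_assoc, h]
  -- `(ε⁻¹ i₁)⁻¹ (ε⁻¹ i₂) = u ∈ H'`, so `i₂ = i₁ · (ε u)`
  have hu := (hH' _).mp ((comp_algebraMap_fixedField_eq_iff σ₀ H' (ε.symm i₁) (ε.symm i₂)).mp h')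
  have key := hε (ε.symm i₁) ((ε.symm i₁)⁻¹ * ε.symm i₂)
  rw [mul_inv_cancel_left, ε.apply_symm_apply, ε.apply_symm_apply] at key
  exact hsep _ hu key.symm

/-- **Every CM-type code is READ by a CM type of `K`** (non-vacuity of the reading hypotheses, automorphism form): with `c` the
automorphism inducing complex conjugation at `σ₀` (`σ₀ ∘ c = σ̄₀`), read as `Γ.conj`, and `T` a mask with `c·T = Tᶜ`, the set
`{σ₀ ∘ g : ε g ∈ T}` is a CM type reading as `T`. [folklore] -/
theorem exists_cmType_reads (hε : ∀ g h : K ≃ₐ[ℚ] K, ε (g * h) = Γ.mul (ε g) (ε h)) (σ₀ : K →+* ℂ)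
    {c : K ≃ₐ[ℚ] K} (hc : σ₀.comp (c : K →+* K) = conjugate σ₀) (hεc : ε c = Γ.conj) (T : ℕ)
    (hT : ∀ i : Fin n, mem (Γ.mul Γ.conj i) T = true ↔ ¬ mem i T = true) :
    ∃ Θ : CMType K, ∀ g : K ≃ₐ[ℚ] K, σ₀.comp (g : K →+* K) ∈ Θ.1 ↔ mem (ε g) T = true := by
  have key : ∀ g : K ≃ₐ[ℚ] K, conjugate (σ₀.comp (g : K →+* K)) = σ₀.comp ((c * g : K ≃ₐ[ℚ] K) : K →+* K) := by
    intro g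
    rw [comp_coe_mul, hc]
    rfl
  refine ⟨⟨{φ | ∃ g : K ≃ₐ[ℚ] K, φ = σ₀.comp (g : K →+* K) ∧ mem (ε g) T = true}, fun φ => ?_⟩, fun g => ?_⟩
  · obtain ⟨g, rfl⟩ := exists_aut_eq σ₀ φ
    constructor
    · rintro ⟨g₁, hg₁, h₁⟩ ⟨g₂, hg₂, h₂⟩
      rw [comp_aut_injective σ₀ hg₁, key] at hg₂
      rw [← comp_aut_injective σ₀ hg₂, hε, hεc, hT] at h₂
      exact h₂ h₁
    · intro h
      by_contra hg
      apply h
      refine ⟨c * g, key g, ?_⟩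
      rw [hε, hεc, hT]
      exact fun hm => hg ⟨g, rfl, hm⟩
  · constructor
    · rintro ⟨g₁, hg₁, h₁⟩
      rw [comp_aut_injective σ₀ hg₁]; exact h₁
    · exact fun h => ⟨g, rfl, h⟩

/-- **From automorphism readings to `GalT` readings** (the currency of the transport files): if `e : GalT K ≃ Fin n` reads `ε` on
translates (`FaceCensus.exists_enum_of_autEnum`), a type reading as `T` through `ε` reads as `T` through `e`. [folklore] -/
theorem reads_galT_of_reads_aut (σ₀ : K →+* ℂ) {e : GalT K ≃ Fin n}
    (he : ∀ g : K ≃ₐ[ℚ] K, e (translate σ₀ (σ₀.comp (g : K →+* K))) = ε g) {Θ : CMType K} {T : ℕ}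
    (hΘ : ∀ g : K ≃ₐ[ℚ] K, σ₀.comp (g : K →+* K) ∈ Θ.1 ↔ mem (ε g) T = true) (P : GalT K) :
    P.1 σ₀ ∈ Θ.1 ↔ mem (e P) T = true := by
  obtain ⟨g, hg⟩ := exists_aut_eq σ₀ (P.1 σ₀)
  have hP : P = translate σ₀ (σ₀.comp (g : K →+* K)) := by rw [← hg, translate_apply_eq]
  rw [hg, hΘ, hP, he]

end Codes

end Summit.HodgeConjecture.CorCM.FaceCensus

end
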